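import Summits.CriticalPhenomena.PercolationContinuityZ3.Theorems.PercNearOneGluingNoHeavyLowerTailKnQuestion8CoefficientwiseCoreClassKernelMixChordedCleanThread
import Summits.CriticalPhenomena.PercolationContinuityZ3.Theorems.PercNearOneGluingNoHeavyLowerTailKnQuestion8CoefficientwiseCoreClassKernelMixIETLayerCake
import HarnessLib

/-!
# Chorded bundles, V: THEOREM CT4 for all monotone real levels — IET on `Θ(ℓ_z,ℓ_x,ℓ_y,1)` with demand off the `z`-blue-starting colourings

Support file (`--supports stmt-CriticalPhenomena-4575`, closed), prover `prim-cplus-coupling` (gen 60).  No definitions, no notations, no named facts,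
no sorries; standard axioms.  Memo `prim-cplus-coupling/A5-COUPLING-gen60.md` §1, §4(A).

SETTING.  An explicit bundle whose threads are exactly `z, x, y, c` with `L c = 1` (the chord); `𝒱` up-closed; `{0,1}`-valued monotone levels; `B_z` = the
colourings blue-starting on `z` (`e z 1` blue, `z` not all blue).
(The 0/1 count is `bundle_chorded_ct_count` of `…KernelMixChordedCleanThread`.)
* `Coefficientwise.iet_chorded_clean_thread` (ALL monotone real levels `0 ≤ hᵃ, hᵇ ≤ h`, `0 ≤ kᵃ, kᵇ ≤ k`, every up-set): the IET functional with DEMAND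
  restricted to the colourings of `𝒱` not blue-starting on `z` (full supply) is nonnegative; in particular CONJECTURE IET holds on `Θ(ℓ₀,ℓ₁,ℓ₂,1)` for every
  `𝒱` with a clean long thread.  Layer cake: `iet_of_indicator_levels` + `iet01_ge_count`.
Exact SAT cross-checks (all 0/1 levels, all up-sets): CT4C UNSAT on Θ(1,2,2,3), Θ(1,2,3,3), Θ(1,3,3,3), Θ(1,2,3,4) (kit j237488).
[cite: KozmaNitzan2024, Questions 8–9 (§5.5 p. 36) (context); Harris 1960]
-/

namespace Summit.CriticalPhenomena.PercolationContinuityZ3.Theorems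

open Finset Literature.Probability.Percolation

namespace Coefficientwise

variable {ι V : Type*}

open Classical in
/-- **THEOREM CT4 (chorded bundle, all monotone real levels, every up-set, every long thread `z`).**  For `0 ≤ hᵃ, hᵇ ≤ h`, `0 ≤ kᵃ, kᵇ ≤ k` monotone and
every up-closed `𝒱`, on an explicit bundle with threads exactly `z, x, y, c`, `L c = 1`, the IET functional whose DEMAND is restricted to the colourings not
blue-starting on `z` is nonnegative: `0 ≤ Σ_{ω ∈ 𝒱, b ∈ X∖Y} h(X) k(X) + Σ_{ω ∈ 𝒱, (e z 1 red ∨ z blue), b ∈ Y∖X} (hᵃX − hᵇY)(kᵃX − kᵇY)`.  In particular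
CONJECTURE IET holds on `Θ(ℓ₀,ℓ₁,ℓ₂,1)` for every `𝒱` having a clean long thread (no source blue-starting on it).  Memo gen 60 §1, §4(A).
[cite: KozmaNitzan2024, Questions 8–9 (§5.5 p. 36) (context); Harris 1960] -/
theorem iet_chorded_clean_thread (ends : ι → Sym2 V) (r : ℕ) (L : ℕ → ℕ) (hL : ∀ t, t < r → 1 ≤ L t)
    (w : ℕ → ℕ → V) (e : ℕ → ℕ → ι) (u b : V)
    (hw0 : ∀ t, t < r → w t 0 = u) (hwL : ∀ t, t < r → w t (L t) = b)
    (harc : ∀ t, t < r → ∀ j, 1 ≤ j → j ≤ L t → ends (e t j) = s(w t (j - 1), w t j))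
    (hwinj : ∀ t, t < r → ∀ i j, i ≤ L t → j ≤ L t → w t i = w t j → i = j)
    (hcross : ∀ t t', t < r → t' < r → t ≠ t' → ∀ i j, i ≤ L t → j ≤ L t' → w t i = w t' j → (i = 0 ∧ j = 0) ∨ (i = L t ∧ j = L t'))
    (A : ℕ → Finset ι) (hA : ∀ t, t < r → ∀ i, i ∈ A t ↔ ∃ j, 1 ≤ j ∧ j ≤ L t ∧ e t j = i)
    (hAdisj : ∀ t t', t < r → t' < r → t ≠ t' → Disjoint (A t) (A t'))
    (E : Finset ι) (hEA : ∀ i, i ∈ E ↔ ∃ t, t < r ∧ i ∈ A t)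
    (z x y c : ℕ) (hz : z < r) (hx : x < r) (hy : y < r) (hc : c < r)
    (hzx : z ≠ x) (hzy : z ≠ y) (hzc : z ≠ c) (hxy : x ≠ y) (hxc : x ≠ c) (hyc : y ≠ c)
    (hr4 : ∀ t, t < r → t = z ∨ t = x ∨ t = y ∨ t = c) (hLc : L c = 1)
    (𝒱 : Finset ι → Prop) (hV : ∀ ⦃s t : Finset ι⦄, s ⊆ t → 𝒱 s → 𝒱 t)
    (h k ha hb ka kb : Set V → ℝ) (mh : Monotone h) (mk : Monotone k)
    (mha : Monotone ha) (mhb : Monotone hb) (mka : Monotone ka) (mkb : Monotone kb)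
    (ha0 : ∀ S, 0 ≤ ha S) (hah : ∀ S, ha S ≤ h S) (hb0 : ∀ S, 0 ≤ hb S) (hbh : ∀ S, hb S ≤ h S)
    (ka0 : ∀ S, 0 ≤ ka S) (kak : ∀ S, ka S ≤ k S) (kb0 : ∀ S, 0 ≤ kb S) (kbk : ∀ S, kb S ≤ k S) :
    0 ≤ (∑ ω ∈ E.powerset, if 𝒱 ω ∧ (b ∈ openCluster (ends '' (↑ω : Set ι)) u ∧ b ∉ openCluster (ends '' (↑(E \ ω) : Set ι)) u) then
        h (openCluster (ends '' (↑ω : Set ι)) u) * k (openCluster (ends '' (↑ω : Set ι)) u) else 0)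
      + ∑ ω ∈ E.powerset, if (𝒱 ω ∧ (e z 1 ∈ ω ∨ Disjoint (A z) ω)) ∧ (b ∈ openCluster (ends '' (↑(E \ ω) : Set ι)) u ∧
          b ∉ openCluster (ends '' (↑ω : Set ι)) u) then
        (ha (openCluster (ends '' (↑ω : Set ι)) u) - hb (openCluster (ends '' (↑(E \ ω) : Set ι)) u)) *
          (ka (openCluster (ends '' (↑ω : Set ι)) u) - kb (openCluster (ends '' (↑(E \ ω) : Set ι)) u)) else 0 := by
  set C : Finset ι → Set V := fun ω => openCluster (ends '' (↑ω : Set ι)) u with hC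
  refine iet_of_indicator_levels E (fun ω => 𝒱 ω ∧ (b ∈ C ω ∧ b ∉ C (E \ ω)))
    (fun ω => (𝒱 ω ∧ (e z 1 ∈ ω ∨ Disjoint (A z) ω)) ∧ (b ∈ C (E \ ω) ∧ b ∉ C ω)) C (fun ω => C (E \ ω)) ?_
    h k ha hb ka kb mh mk mha mhb mka mkb ha0 hah hb0 hbh ka0 kak kb0 kbk
  intro h k ha hb ka kb mh mk mha mhb mka mkb h01 k01 ha01 hb01 ka01 kb01 hah hbh kak kbk
  have cnt := iet01_ge_count E (fun ω => 𝒱 ω ∧ (b ∈ C ω ∧ b ∉ C (E \ ω)))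
    (fun ω => (𝒱 ω ∧ (e z 1 ∈ ω ∨ Disjoint (A z) ω)) ∧ (b ∈ C (E \ ω) ∧ b ∉ C ω)) C (fun ω => C (E \ ω)) h k ha hb ka kb h01 k01 ha01 hb01 ka01 kb01
  have ct := bundle_chorded_ct_count ends r L hL w e u b hw0 hwL harc hwinj hcross A hA hAdisj E hEA z x y c hz hx hy hc hzx hzy hzc hxy hxc hyc hr4 hLc 𝒱 hV
    ha hb ka kb mha mhb mka mkb ha01 hb01 ka01 kb01
  have up1 : ∀ (f g : Set V → ℝ), (∀ S, g S = 0 ∨ g S = 1) → (∀ S, f S ≤ g S) → ∀ S, f S = 1 → g S = 1 := by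
    intro f g g01 hfg S e1; rcases g01 S with h0 | h0
    · have := hfg S; rw [e1, h0] at this; linarith
    · exact h0
  -- demand-side sums are the clean source counts
  have d1 : (∑ ω ∈ E.powerset, if ((𝒱 ω ∧ (e z 1 ∈ ω ∨ Disjoint (A z) ω)) ∧ (b ∈ C (E \ ω) ∧ b ∉ C ω)) ∧
        ha (C ω) = 1 ∧ kb (C (E \ ω)) = 1 ∧ hb (C (E \ ω)) = 0 ∧ ka (C ω) = 0 then (1 : ℝ) else 0) ≤
      (((E.powerset).filter (fun σ => (e z 1 ∈ σ ∨ Disjoint (A z) σ) ∧ 𝒱 σ ∧ (b ∈ C (E \ σ) ∧ b ∉ C σ) ∧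
        (ha (C σ) = 1 ∧ hb (C (E \ σ)) = 0) ∧ (kb (C (E \ σ)) = 1 ∧ ka (C σ) = 0))).card : ℝ) := by
    rw [Finset.natCast_card_filter]
    refine Finset.sum_le_sum fun ω _ => ?_
    by_cases hP : ((𝒱 ω ∧ (e z 1 ∈ ω ∨ Disjoint (A z) ω)) ∧ (b ∈ C (E \ ω) ∧ b ∉ C ω)) ∧
        ha (C ω) = 1 ∧ kb (C (E \ ω)) = 1 ∧ hb (C (E \ ω)) = 0 ∧ ka (C ω) = 0
    · rw [if_pos hP, if_pos ⟨hP.1.1.2, hP.1.1.1, hP.1.2, ⟨hP.2.1, hP.2.2.2.1⟩, ⟨hP.2.2.1, hP.2.2.2.2⟩⟩]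
    · rw [if_neg hP]; split_ifs <;> norm_num
  have d2 : (∑ ω ∈ E.powerset, if ((𝒱 ω ∧ (e z 1 ∈ ω ∨ Disjoint (A z) ω)) ∧ (b ∈ C (E \ ω) ∧ b ∉ C ω)) ∧
        hb (C (E \ ω)) = 1 ∧ ka (C ω) = 1 ∧ ha (C ω) = 0 ∧ kb (C (E \ ω)) = 0 then (1 : ℝ) else 0) ≤
      (((E.powerset).filter (fun σ => (e z 1 ∈ σ ∨ Disjoint (A z) σ) ∧ 𝒱 σ ∧ (b ∈ C (E \ σ) ∧ b ∉ C σ) ∧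
        (ka (C σ) = 1 ∧ kb (C (E \ σ)) = 0) ∧ (hb (C (E \ σ)) = 1 ∧ ha (C σ) = 0))).card : ℝ) := by
    rw [Finset.natCast_card_filter]
    refine Finset.sum_le_sum fun ω _ => ?_
    by_cases hP : ((𝒱 ω ∧ (e z 1 ∈ ω ∨ Disjoint (A z) ω)) ∧ (b ∈ C (E \ ω) ∧ b ∉ C ω)) ∧
        hb (C (E \ ω)) = 1 ∧ ka (C ω) = 1 ∧ ha (C ω) = 0 ∧ kb (C (E \ ω)) = 0
    · rw [if_pos hP, if_pos ⟨hP.1.1.2, hP.1.1.1, hP.1.2, ⟨hP.2.2.1, hP.2.2.2.2⟩, ⟨hP.2.1, hP.2.2.2.1⟩⟩]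
    · rw [if_neg hP]; split_ifs <;> norm_num
  -- the counted P₁ points are among the P₁ terms of the restricted functional
  have d3 : (((E.powerset).filter (fun σ => (e z 1 ∈ σ ∨ Disjoint (A z) σ) ∧ 𝒱 σ ∧ (b ∈ C (E \ σ) ∧ b ∉ C σ) ∧
        (ha (C σ) = 1 ∧ ka (C σ) = 1 ∧ hb (C (E \ σ)) = 0 ∧ kb (C (E \ σ)) = 0))).card : ℝ) ≤
      ∑ ω ∈ E.powerset, if ((𝒱 ω ∧ (e z 1 ∈ ω ∨ Disjoint (A z) ω)) ∧ (b ∈ C (E \ ω) ∧ b ∉ C ω)) ∧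
        ha (C ω) = 1 ∧ ka (C ω) = 1 ∧ hb (C (E \ ω)) = 0 ∧ kb (C (E \ ω)) = 0 then (1 : ℝ) else 0 := by
    rw [Finset.natCast_card_filter]
    refine Finset.sum_le_sum fun ω _ => ?_
    by_cases hP : (e z 1 ∈ ω ∨ Disjoint (A z) ω) ∧ 𝒱 ω ∧ (b ∈ C (E \ ω) ∧ b ∉ C ω) ∧ (ha (C ω) = 1 ∧ ka (C ω) = 1 ∧ hb (C (E \ ω)) = 0 ∧ kb (C (E \ ω)) = 0)
    · rw [if_pos hP, if_pos ⟨⟨⟨hP.2.1, hP.1⟩, hP.2.2.1⟩, hP.2.2.2⟩]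
    · rw [if_neg hP]; split_ifs <;> norm_num
  -- supply side: L₁ ∪ L₂ ⊆ S
  have s1 : (((E.powerset).filter (fun lam => e z 1 ∈ lam ∧ 𝒱 lam ∧ (b ∈ C lam ∧ b ∉ C (E \ lam)) ∧
      ((ha (C lam) = 1 ∧ kb (C lam) = 1 ∧ hb (C (E \ lam)) = 0 ∧ ka (C (E \ lam)) = 0) ∨
        (ka (C lam) = 1 ∧ hb (C lam) = 1 ∧ kb (C (E \ lam)) = 0 ∧ ha (C (E \ lam)) = 0)))).card : ℝ) ≤
      ∑ ω ∈ E.powerset, if (𝒱 ω ∧ (b ∈ C ω ∧ b ∉ C (E \ ω))) ∧ h (C ω) = 1 ∧ k (C ω) = 1 then (1 : ℝ) else 0 := by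
    rw [Finset.natCast_card_filter]
    refine Finset.sum_le_sum fun ω _ => ?_
    by_cases hP : e z 1 ∈ ω ∧ 𝒱 ω ∧ (b ∈ C ω ∧ b ∉ C (E \ ω)) ∧
        ((ha (C ω) = 1 ∧ kb (C ω) = 1 ∧ hb (C (E \ ω)) = 0 ∧ ka (C (E \ ω)) = 0) ∨
          (ka (C ω) = 1 ∧ hb (C ω) = 1 ∧ kb (C (E \ ω)) = 0 ∧ ha (C (E \ ω)) = 0))
    · have hQ : (𝒱 ω ∧ (b ∈ C ω ∧ b ∉ C (E \ ω))) ∧ h (C ω) = 1 ∧ k (C ω) = 1 := by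
        refine ⟨⟨hP.2.1, hP.2.2.1⟩, ?_⟩
        rcases hP.2.2.2 with hL' | hL'
        · exact ⟨up1 ha h h01 hah _ hL'.1, up1 kb k k01 kbk _ hL'.2.1⟩
        · exact ⟨up1 hb h h01 hbh _ hL'.2.1, up1 ka k k01 kak _ hL'.1⟩
      rw [if_pos hP, if_pos hQ]
    · rw [if_neg hP]; split_ifs <;> norm_num
  have ct' : (((E.powerset).filter (fun σ => (e z 1 ∈ σ ∨ Disjoint (A z) σ) ∧ 𝒱 σ ∧ (b ∈ C (E \ σ) ∧ b ∉ C σ) ∧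
        (ha (C σ) = 1 ∧ hb (C (E \ σ)) = 0) ∧ (kb (C (E \ σ)) = 1 ∧ ka (C σ) = 0))).card : ℝ) +
      (((E.powerset).filter (fun σ => (e z 1 ∈ σ ∨ Disjoint (A z) σ) ∧ 𝒱 σ ∧ (b ∈ C (E \ σ) ∧ b ∉ C σ) ∧
        (ka (C σ) = 1 ∧ kb (C (E \ σ)) = 0) ∧ (hb (C (E \ σ)) = 1 ∧ ha (C σ) = 0))).card : ℝ) ≤
      (((E.powerset).filter (fun lam => e z 1 ∈ lam ∧ 𝒱 lam ∧ (b ∈ C lam ∧ b ∉ C (E \ lam)) ∧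
        ((ha (C lam) = 1 ∧ kb (C lam) = 1 ∧ hb (C (E \ lam)) = 0 ∧ ka (C (E \ lam)) = 0) ∨
          (ka (C lam) = 1 ∧ hb (C lam) = 1 ∧ kb (C (E \ lam)) = 0 ∧ ha (C (E \ lam)) = 0)))).card : ℝ) +
      (((E.powerset).filter (fun σ => (e z 1 ∈ σ ∨ Disjoint (A z) σ) ∧ 𝒱 σ ∧ (b ∈ C (E \ σ) ∧ b ∉ C σ) ∧
        (ha (C σ) = 1 ∧ ka (C σ) = 1 ∧ hb (C (E \ σ)) = 0 ∧ kb (C (E \ σ)) = 0))).card : ℝ) := by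
    have hnat := (Nat.cast_le (α := ℝ)).mpr ct
    rw [Nat.cast_add, Nat.cast_add] at hnat
    convert hnat using 4
  refine le_trans ?_ cnt
  linarith [d1, d2, d3, s1, ct']

end Coefficientwise

end Summit.CriticalPhenomena.PercolationContinuityZ3.Theorems
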